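import Summits.BirchSwinnertonDyer.Rank1Residual.Additive.BudgetFromRationalClasses
import Summits.BirchSwinnertonDyer.Rank1Residual.Additive.RationalClassesToLayerZero
import Summits.BirchSwinnertonDyer.Rank1Residual.Additive.BudgetFromRankGrowth
import Literature.NumberTheory.EllipticCurves.SelmerFiniteProofs
import HarnessLib

/-!
# ARM σ — the Route-G budget from ONE `p`-descent over `ℚ` (the Ш-door), and the rank-0 END shapes
# with it (cell `b2b-bsdres`, team n1011; r2 ROUTE-2 §II.18.3 sub-target ST-18.1; typed and
# `lean check`ed by n1011-r2 GEN 12 as `cells/n1011/route2/g12/ArmSigmaCheck.lean`, landed by the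
# prover seat per lead R5-51/R5-52 deal — r2 lands no Lean)

HONEST FRAMING (cell `b2b-bsdres`, run/shared/lean/b2b/bsd-rank1-residual/, verbatim in every
file): the goal of the cell is to DELETE the COMBINATION-SHAPED residual classes of the
Birch–Swinnerton-Dyer formula for ALL analytic-rank `≤ 1` elliptic curves over `ℚ` — "full BSD
formula for every rank `≤ 1` curve in class `C`" assembled STRICTLY from published theorems — so
that the rank-`≤ 1` remainder becomes exactly the CONSTRUCTION-SHAPED classes, which are TYPED
(missing-input `Prop`s), NOT attempted. This is not "finishing BSD". Team n1011 (N10 / N11, the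
Route-G budget node): research route; no claim beyond the stated classes; nothing is booked; marks
UNCHANGED; NOT a yield claim. Theorems only: no definition, no named fact, no `sorry`.

## What and why

p10's FILE 1 (`budgetLeLambdaAt_of_prop414_of_layerClasses`, level `n = 0`) and FILE 2
(`exists_finset_torsion_selmerInftyPreimage_zero_card_eq_selmerGroup`) compose to a three-line
door: on rows with `p ∤ #E(ℚ)_tors`, a LOWER BOUND `p ^ b ≤ #Sel⁽ᵖ⁾(E/ℚ)` (the cheap,
exhibit-elements half of a `p`-descent) IS a Route-G budget `BudgetLeLambdaAt p W b` — the
`p`-Selmer classes restrict injectively into `A_0[p] ⊆ Sel_{p^∞}(E/ℚ_∞)[p]`, of order `p^λ`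
(Greenberg LNM 1716 §3 pp. 85–86, Prop. 4.14). At analytic rank `0` this is a `Ш[p]`-budget
(`Sel⁽ᵖ⁾ = Ш[p]` when `E(ℚ)/p = 0`), the lower input the LOWER rows of the E3 / X3 censuses lack; it
completes the END shape "half + certificate@`b` + budget `b`", `b ∈ {r (ρ), #T₀ (BUD0), Ш (σ)}`.

* `budgetLeLambdaAt_of_prop414_of_pow_le_card_selmerGroup` (Prop. 4.14 record form) and
  `budgetLeLambdaAt_of_noFiniteSubmodule_of_pow_le_card_selmerGroup` (cc-typer-2's
  `NoFiniteSubmoduleAt` form): **`p ∤ #E(ℚ)_tors ∧ p ^ b ≤ #Sel⁽ᵖ⁾(E/ℚ) ⟹ BudgetLeLambdaAt p W b`.**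
* Rank-0 END one-liners at `p = 3` with the σ-budget: `ClassX4M.…_of_pow_le_card_selmerGroup`
  (N11 (M) rows, over p07's `…_of_firstUnitIndex_of_budget`) and
  `ClassX4Gord.…_of_pow_le_card_selmerGroup_of_nonAnomalous` (N11 (G-ord) rows, over p10's
  `…_of_coeffCert_of_budget_of_nonAnomalous_noPal`); binders = the parents' named facts + Greenberg
  Prop. 4.14 + the certificate lines `hrec` / `hcert` + `hSel : 3 ^ b ≤ #Sel⁽³⁾(E/ℚ)`.

References: R. Greenberg, LNM 1716 (1999), §3 pp. 85–86, Prop. 4.14 (p. 114).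
-/

noncomputable section

open scoped Classical

open WeierstrassCurve NumberField Literature.NumberTheory.EllipticCurves
  Literature.NumberTheory.EllipticCurves.ModularForms
  Literature.NumberTheory.EllipticCurves.Rank1Residual
  Literature.NumberTheory.EllipticCurves.Rank1Residual.Typed
  Literature.NumberTheory.EllipticCurves.Delbourgo2002
  Literature.NumberTheory.GaloisRepresentations
  Summit.BirchSwinnertonDyer.Rank1Residual.Iwasawa
  Summit.BirchSwinnertonDyer.Rank1Residual.Additive
  Summit.BirchSwinnertonDyer.Rank1Residual.Additive.CensusQ6
  Summit.BirchSwinnertonDyer.Rank1Residual.AdditivePotMult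

namespace Summit.BirchSwinnertonDyer.Rank1Residual.Additive

variable {W : WeierstrassCurve ℚ} [W.IsElliptic] [W.IsGloballyMinimal] {p : ℕ} [hp : Fact p.Prime]

/-- **ARM σ — the Route-G budget from ONE `p`-descent over `ℚ`.** On a row with `p ∤ #E(ℚ)_tors`
(so `E(ℚ)[p] = 0` and Greenberg's Prop. 4.14 record applies), any certified lower bound
`p ^ b ≤ #Sel⁽ᵖ⁾(E/ℚ)` gives `BudgetLeLambdaAt p W b`: the `p`-Selmer classes restrict injectively
into `A_0[p] ⊆ Sel_{p^∞}(E/ℚ_∞)[p]`, whose order is `p ^ λ`.  At analytic rank `0` this is a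
`Ш[p]`-budget (`Sel⁽ᵖ⁾ = Ш[p]`), the lower input the LOWER rows of the E3 census lack.
[cite: GreenbergLNM1716, §3 pp. 85–86 and Prop. 4.14 (p. 114)] -/
theorem budgetLeLambdaAt_of_prop414_of_pow_le_card_selmerGroup
    (h414 : Greenberg1999.prop414_noFiniteSubmodule_of_not_dvd_torsionOrder)
    (htors : ¬ p ∣ W.torsionOrder) {b : ℕ}
    (hb : p ^ b ≤ Nat.card (selmerGroup W (p : ℤ))) : BudgetLeLambdaAt p W b := by
  haveI : Finite (selmerGroup W (p : ℤ)) :=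
    finite_selmerGroup_holds W (by exact_mod_cast hp.out.ne_zero)
  have hA : ∀ κ : ZpExtension ℚ p, κ.IsCyclotomic →
      ∃ s : Finset {y : W.selmerInftyPreimage κ 0 // p • y = 0}, p ^ b ≤ s.card := fun κ _ ↦ by
    obtain ⟨s, hs⟩ := exists_finset_torsion_selmerInftyPreimage_zero_card_eq_selmerGroup W p κ
      (forall_smul_eq_zero_of_not_dvd_torsionOrder W p htors)
    exact ⟨s, hs ▸ hb⟩
  intro κ γ hκ hγ hT D _ hXt hμ
  exact budgetLeLambdaAt_of_prop414_of_layerClasses h414 htors 0 hA hκ hγ hT D hXt hμ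

/-- ARM σ, no-finite-submodule form (cc-typer-2's `NoFiniteSubmoduleAt p W` instead of the
Prop. 4.14 record). [cite: GreenbergLNM1716, §3 pp. 85–86] -/
theorem budgetLeLambdaAt_of_noFiniteSubmodule_of_pow_le_card_selmerGroup
    (htors : ¬ p ∣ W.torsionOrder) (hnf : NoFiniteSubmoduleAt p W) {b : ℕ}
    (hb : p ^ b ≤ Nat.card (selmerGroup W (p : ℤ))) : BudgetLeLambdaAt p W b := by
  haveI : Finite (selmerGroup W (p : ℤ)) :=
    finite_selmerGroup_holds W (by exact_mod_cast hp.out.ne_zero)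
  have hA : ∀ κ : ZpExtension ℚ p, κ.IsCyclotomic →
      ∃ s : Finset {y : W.selmerInftyPreimage κ 0 // p • y = 0}, p ^ b ≤ s.card := fun κ _ ↦ by
    obtain ⟨s, hs⟩ := exists_finset_torsion_selmerInftyPreimage_zero_card_eq_selmerGroup W p κ
      (forall_smul_eq_zero_of_not_dvd_torsionOrder W p htors)
    exact ⟨s, hs ▸ hb⟩
  intro κ γ hκ hγ hT D _ hXt hμ
  exact budgetLeLambdaAt_of_noFiniteSubmodule_of_layerClasses htors hnf 0 hA hκ hγ hT D hXt hμ

end Summit.BirchSwinnertonDyer.Rank1Residual.Additive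

/-! ### Per-pair END shapes with the σ-budget (the N11 rows, `p = 3`): the certificate line is
`hSel : 3 ^ b ≤ #Sel⁽³⁾(E/ℚ)` — the exhibit-`b`-independent-elements half of a 3-descent. -/

namespace Summit.BirchSwinnertonDyer.Rank1Residual.AdditivePotMult

open Summit.BirchSwinnertonDyer.Rank1Residual.Additive

/-- **X4(M) ∧ surj(3) ∧ `r_an = 0` (N11 (M) rows, census status `OPEN:LOWER(M)[+TAM]`): `BSD(E,3)` ⟸
the odd record `MultOddFirstUnitIndexAt W 3 b` + `3 ^ b ≤ #Sel⁽³⁾(E/ℚ)`** — p07's end with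
`hbud` from ARM σ (`p ∤ #E(ℚ)_tors` from `Surj`). [cite: GreenbergLNM1716, Prop. 4.14 (p. 114)] -/
theorem ClassX4M.bsdp_three_rankZero_of_surj_of_katoHalf_of_firstUnitIndex_of_pow_le_card_selmerGroup
    [Fact (Nat.Prime 3)] {W : WeierstrassCurve ℚ} [W.IsElliptic] [W.IsGloballyMinimal]
    (hK : Wuthrich2014.kato_halfEigenCharIdeal_dvd_cyclotomicPrime_of_surjective)
    (hDel : Delbourgo1998.prop4_rankZero_pow_dvd_constantCoeff)
    (hDelX : Delbourgo1998.prop4_rankZero_constantCoeff_eq_unit_mul_of_potMult)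
    (hPal : Pal2012.thm32_sqrt_mul_realPeriodRat_twist_eq_of_prime_one_mod_four)
    (hGZK : rank_eq_analyticRank_of_analyticRank_le_one) (hmod : hasEntireLFunction_rat)
    (hmodD : nonempty_modularParametrizationData)
    (h414 : Greenberg1999.prop414_noFiniteSubmodule_of_not_dvd_torsionOrder)
    (hX : ClassX4M W 3) (hsurj : Surj W 3) (hr : W.analyticRank = 0) {b : ℕ}
    (hrec : MultOddFirstUnitIndexAt W 3 b) (hSel : 3 ^ b ≤ Nat.card (selmerGroup W (3 : ℤ))) :
    BSDp W 3 :=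
  hX.bsdp_three_rankZero_of_surj_of_katoHalf_of_firstUnitIndex_of_budget hK hDel hDelX hPal hGZK hmod
    hmodD hsurj hr hrec
    (budgetLeLambdaAt_of_prop414_of_pow_le_card_selmerGroup h414 (not_dvd_torsionOrder_of_surj 3 W hsurj)
      hSel)

end Summit.BirchSwinnertonDyer.Rank1Residual.AdditivePotMult

namespace Summit.BirchSwinnertonDyer.Rank1Residual.Additive

/-- **X4♯(G-ord) at `3` ∧ surj(3), `r_an = 0`, non-CM, non-anomalous (N11 (G-ord) rows, census status
`OPEN:LOWER(pure)` / `OPEN:LOWER+TAM`): `BSD(E,3)` ⟸ ONE 3-adic unit coefficient at index `b` +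
`3 ^ b ≤ #Sel⁽³⁾(E/ℚ)`** — p10's `…_noPal` end with `hbud` from ARM σ.
[cite: GreenbergLNM1716, Prop. 4.14 (p. 114)] -/
theorem ClassX4Gord.bsdp_three_rankZero_of_katoHalf_of_coeffCert_of_pow_le_card_selmerGroup_of_nonAnomalous
    [Fact (Nat.Prime 3)] {W : WeierstrassCurve ℚ} [W.IsElliptic] [W.IsGloballyMinimal]
    (hK : Wuthrich2014.kato_halfEigenCharIdeal_dvd_cyclotomicPrime_of_surjective)
    (hDel98 : Delbourgo1998.prop4_rankZero_pow_dvd_constantCoeff)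
    (hDel3 : Delbourgo2002.mainTheorem_three)
    (hGZK : rank_eq_analyticRank_of_analyticRank_le_one) (hmod : hasEntireLFunction_rat)
    (hmodD : nonempty_modularParametrizationData)
    (h414 : Greenberg1999.prop414_noFiniteSubmodule_of_not_dvd_torsionOrder)
    (hX : ClassX4Gord W 3) (hcm : ¬ W.HasCM) (hsurj : Surj W 3) (hr : W.analyticRank = 0)
    {b : ℕ} (hcert : BranchUnitCoeffAt W 3 b) (hSel : 3 ^ b ≤ Nat.card (selmerGroup W (3 : ℤ)))
    (hna : ReductionNonAnomalous W 3) : BSDp W 3 :=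
  ClassX4Gord.bsdp_three_rankZero_of_katoHalf_of_coeffCert_of_budget_of_nonAnomalous_noPal hK hDel98
    hDel3 hGZK hmod hmodD hX hcm hsurj hr hcert
    (budgetLeLambdaAt_of_prop414_of_pow_le_card_selmerGroup h414 (not_dvd_torsionOrder_of_surj 3 W hsurj)
      hSel) hna

end Summit.BirchSwinnertonDyer.Rank1Residual.Additive

end
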